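import Summits.ValiantsHypothesis.ValiantsHypothesis.Theorems.GrenetZeonZeonPoint
import Literature.Computability.AlgebraicComplexity.AlgDetRepr
import HarnessLib

/-!
# Crux `GrenetZeon.AbelianizationQP` (stmt-ValiantsHypothesis-8063), line `zeon-window` —
registered stub `stub_zeonPoint`: THE ZEON POINT `(n, 2^n)` IN `HasAlgDetRepr` FORM

**Claim settled** (stub 1 of the registered skeleton `Lines/zeon_window.lean`, TRUE): for `n ≥ 1`,
`per_n` has an `(n, 2^n)`-representation — an `n × n` matrix of affine linear forms with
coefficients in a commutative ℂ-algebra `R` of dimension `≤ 2^n` and a functional `λ : R → ℂ` with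
`per_n = λ(det)` coefficientwise (`HasAlgDetRepr (perPoly (Fin n) ℂ) n (2 ^ n)`).

Proof.  The route's Glynn point (`GlynnPoint`, stmt-8067, proved in
`GrenetZeonGlynnPoint.lean` as `glynnPoint_proof`: Glynn's formula
`per_n = 2^{1-n} Σ_{δ ∈ {±1}^n, δ₁ = 1} (∏ δ_k) ∏_i (Σ_j δ_j x_ij)` is an `n × n` diagonal determinant
over the algebra of functions on the half cube, of dimension `2^{n-1}`) is, token for token, an
`(n, 2^{n-1})`-representation (`HasAlgDetRepr` inlines the route's `∃`-form, `Iff.rfl`); pad the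
dimension bound `2^{n-1} ≤ 2^n` (`HasAlgDetRepr.mono`).  The zeon algebra `ℂ[z]/(z_i²)` named in the
stub's docstring is one witness among several and is not needed for the signature.

Honest framing: bookkeeping over a classical identity (Glynn 2010); this closes one of the two
registered stubs of the line — the other, `stub_subexpAbelianization`, carries the whole content of
the crux (open-problem grade) and is untouched here.  Nothing here is progress on VP ≠ VNP.
Unconditional (axioms `propext`, `Classical.choice`, `Quot.sound`).
-/

set_option linter.dupNamespace false

noncomputable section

namespace Summit.ValiantsHypothesis.ValiantsHypothesis.Theorems.GrenetZeonAbelianizationQP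

open Literature.Computability.AlgebraicComplexity
open Summit.ValiantsHypothesis.ValiantsHypothesis.Theses.GrenetZeon
open Summit.ValiantsHypothesis.ValiantsHypothesis.Theorems.GrenetZeonGlynn

/-- The Glynn point read as an `(n, 2^{n-1})`-representation: for `n ≥ 1`,
`HasAlgDetRepr (perPoly (Fin n) ℂ) n (2 ^ (n - 1))` (the route statement `GlynnPoint` inlines the
definition of `HasAlgDetRepr` verbatim). [cite: Glynn2010, Thm. 2.1] -/
theorem hasAlgDetRepr_perPoly_glynn (n : ℕ) (hn : 1 ≤ n) :
    HasAlgDetRepr (perPoly (Fin n) ℂ) n (2 ^ (n - 1)) :=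
  glynnPoint_proof n hn

/-- **Registered stub `stub_zeonPoint`** (line `zeon-window` of crux `AbelianizationQP`,
stmt-ValiantsHypothesis-8063; = support item `ZeonPoint`, stmt-8066, in `HasAlgDetRepr` form): for
`n ≥ 1`, `per_n` has an `(n, 2^n)`-representation.  From the Glynn point `(n, 2^{n-1})` by
monotonicity in the dimension parameter (`2^{n-1} ≤ 2^n`). [cite: Glynn2010, Thm. 2.1] -/
theorem stub_zeonPoint (n : ℕ) (hn : 1 ≤ n) : HasAlgDetRepr (perPoly (Fin n) ℂ) n (2 ^ n) :=
  (hasAlgDetRepr_perPoly_glynn n hn).mono le_rfl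
    (Nat.pow_le_pow_right (by norm_num) (Nat.sub_le n 1))

/-- The zeon point for every `n` (including `n = 0`, where `per_0 = 1 = det` of the empty matrix
over `R = ℂ`): `HasAlgDetRepr (perPoly (Fin n) ℂ) n (2 ^ n)` — the route item `ZeonPoint`
(`zeonPoint_proof`) read through `hasAlgDetRepr_iff`. [cite: Glynn2010, Thm. 2.1] -/
theorem hasAlgDetRepr_perPoly_zeon (n : ℕ) : HasAlgDetRepr (perPoly (Fin n) ℂ) n (2 ^ n) :=
  zeonPoint_proof n

end Summit.ValiantsHypothesis.ValiantsHypothesis.Theorems.GrenetZeonAbelianizationQP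

end
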